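import Summits.ValiantsHypothesis.ValiantsHypothesis.Theorems.LacunarySymmetroidMatrixDescartesCensusPivotDefs
import Summits.ValiantsHypothesis.ValiantsHypothesis.Theorems.LacunarySymmetroidMatrixDescartesCensusFrame

/-!
# `MatrixDescartes` census — pivot column ↔ census rows: a pivot pencil of format `(m, K)` IS a `(K+1)`-term symmetric pencil

HONEST FRAMING.  Bookkeeping for the object-search cell `pub-symmetroid` (typer g8): the precise sense of the sentence of
record «pivot counts are NOT Table-S rows» (lead R1332).  A pivot pencil `X^e • J + ∑ₖ X^{d k} • P k` of format `(m, K)`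
(`…CensusPivotDefs.lean`) is the symmetric `(K+1)`-term pencil with exponents `Fin.cons e d` and letters `Fin.cons J P`
(`pivot_pencil_eq_cons`; PSD letters are symmetric), so every census row in `ζ`-currency at format `(m, K+1)` transfers
to the pivot column at format `(m, K)` for EVERY index: `pivotRootLawAt_of_posRootLawAt : PosRootLawAt m (K+1) B →
PivotRootLawAt m K q B`; in particular the Descartes ceiling `pivotRootLawAt_descartes : PivotRootLawAt m K q (C(m+K, m) − 1)`
(tree `Census.posRootLawAt_descartes`).  The converse direction is where the column lives (the index hypothesis
`J + W Wᵀ ⪰ 0` is extra structure), and rows are monotone in the index: `pivotRootLawAt_of_le_index` (pad `W` with zero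
columns).  Landed as a HELPER of the crux item stmt-ValiantsHypothesis-18050 with no closure claim; nothing here bears on
`Theses.LacunarySymmetroid.MatrixDescartes`, on `KPlusLogSqLaw`, on the census registers, or on `VP ≠ VNP`.

[folklore] Re-indexing a finite sum; `W ↦ [W | 0]`.
-/

-- `Summit.ValiantsHypothesis.ValiantsHypothesis.…` repeats a component by the D-0017 layout
-- (single-conjunct summit), which the `dupNamespace` linter flags; the name is mandated.
set_option linter.dupNamespace false

namespace Summit.ValiantsHypothesis.ValiantsHypothesis.Theorems.LacunarySymmetroidMatrixDescartes.Pivot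

open Summit.ValiantsHypothesis.ValiantsHypothesis.Theorems.MatrixDescartes.Negative (PosRootLawAt)
open Summit.ValiantsHypothesis.ValiantsHypothesis.Theorems.LacunarySymmetroidMatrixDescartes.Census (posRootLawAt_descartes)
open scoped BigOperators Matrix
open Polynomial

/-- A pivot pencil is the `(K+1)`-term pencil with exponents `Fin.cons e d` and letters `Fin.cons J P`. [folklore] -/
theorem pivot_pencil_eq_cons {m K : ℕ} (e : ℕ) (d : Fin K → ℕ) (J : Matrix (Fin m) (Fin m) ℝ)
    (P : Fin K → Matrix (Fin m) (Fin m) ℝ) :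
    ((X : ℝ[X]) ^ e) • J.map Polynomial.C + ∑ k, ((X : ℝ[X]) ^ d k) • (P k).map Polynomial.C
      = ∑ l : Fin (K + 1), ((X : ℝ[X]) ^ (Fin.cons e d : Fin (K + 1) → ℕ) l) •
          ((Fin.cons J P : Fin (K + 1) → Matrix (Fin m) (Fin m) ℝ) l).map Polynomial.C := by
  rw [Fin.sum_univ_succ]
  simp only [Fin.cons_zero, Fin.cons_succ]

/-- A real positive-semidefinite matrix is symmetric. [folklore] -/
theorem isSymm_of_posSemidef {m : ℕ} {M : Matrix (Fin m) (Fin m) ℝ} (hM : M.PosSemidef) : M.IsSymm := by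
  have h := hM.isHermitian
  unfold Matrix.IsHermitian at h
  rwa [Matrix.conjTranspose_eq_transpose_of_trivial] at h

/-- **Census row ⇒ pivot row.**  Every `ζ`-currency row at format `(m, K+1)` holds for pivot pencils of format `(m, K)`
at every index `q`: `PosRootLawAt m (K+1) B → PivotRootLawAt m K q B`. [folklore] -/
theorem pivotRootLawAt_of_posRootLawAt {m K q B : ℕ} (h : PosRootLawAt m (K + 1) B) : PivotRootLawAt m K q B := by
  intro e d J P hJ hP _
  unfold pivotPosRoots
  rw [pivot_pencil_eq_cons]
  refine h (Fin.cons e d) (Fin.cons J P) fun l => ?_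
  refine Fin.cases ?_ (fun k => ?_) l
  · simpa only [Fin.cons_zero] using hJ
  · simpa only [Fin.cons_succ] using isSymm_of_posSemidef (hP k)

/-- **Descartes ceiling for the pivot column**: `PivotRootLawAt m K q (C(m+K, m) − 1)` for all `m K q`
(a pivot pencil of format `(m,K)` has `K + 1` letters; tree `Census.posRootLawAt_descartes`). [folklore] -/
theorem pivotRootLawAt_descartes (m K q : ℕ) : PivotRootLawAt m K q (Nat.choose (m + K) m - 1) := by
  have h := posRootLawAt_descartes m (K + 1) (Nat.succ_pos K)
  rw [show m + (K + 1) - 1 = m + K by omega] at h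
  exact pivotRootLawAt_of_posRootLawAt h

/-- Padding `W` with `r` zero columns does not change `W Wᵀ`. [folklore] -/
theorem append_zero_mul_transpose {m q r : ℕ} (W : Matrix (Fin m) (Fin q) ℝ) :
    (Matrix.of fun i (j : Fin (q + r)) => Fin.append (W i) (0 : Fin r → ℝ) j)
        * (Matrix.of fun i (j : Fin (q + r)) => Fin.append (W i) (0 : Fin r → ℝ) j)ᵀ = W * Wᵀ := by
  ext i i'
  simp only [Matrix.mul_apply, Matrix.transpose_apply, Matrix.of_apply, Fin.sum_univ_add, Fin.append_left,
    Fin.append_right, Pi.zero_apply, mul_zero, Finset.sum_const_zero, add_zero]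

/-- **Rows are monotone in the index**: a law at index `q + r` implies the law at index `q` (a pivot of index `≤ q` has
index `≤ q + r`: pad `W` with zero columns). [folklore] -/
theorem pivotRootLawAt_of_le_index {m K q r B : ℕ} (h : PivotRootLawAt m K (q + r) B) : PivotRootLawAt m K q B := by
  intro e d J P hJ hP hW
  obtain ⟨W, hW⟩ := hW
  refine h e d J P hJ hP ⟨Matrix.of fun i (j : Fin (q + r)) => Fin.append (W i) (0 : Fin r → ℝ) j, ?_⟩
  rwa [append_zero_mul_transpose]

/-- Index `0` is the definite case: `PivotRootLawAt m K 0 B` quantifies over pivots with `J ⪰ 0` (then the whole pencil is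
one-sided-trivially a sum of PSD letters); any law at a positive index implies it. [bookkeeping] -/
theorem pivotRootLawAt_zero_of {m K q B : ℕ} (h : PivotRootLawAt m K q B) : PivotRootLawAt m K 0 B :=
  pivotRootLawAt_of_le_index (r := q) (by simpa only [Nat.zero_add] using h)

end Summit.ValiantsHypothesis.ValiantsHypothesis.Theorems.LacunarySymmetroidMatrixDescartes.Pivot
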